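import Summits.BirchSwinnertonDyer.Rank1Residual.X12.O11.RouteUEvenMember
import Summits.BirchSwinnertonDyer.Rank1Residual.X12.O11.RouteUEulerCriterionNat
import HarnessLib

/-!
# ROUTE U, EVEN member `D = −40` (curve `49a1^{(−40)}`, `N = 49·40² = 78400`), Heegner field
# `K'' = ℚ(√−199)`: the two Bernoulli-unit certificates and BSD₇ by the even-member class theorem

bsd-cm cell (run/shared/lean/pub/bsd-cm/), ROUTE U, seat `bsd-cm-ram` (g6). Instance of
`RouteU.bsdp_seven_of_twist_cm7_even` at `(n, r) = (10, 199)`: `10 ≡ 2 (mod 4)` squarefree, `7 ∤ 10`,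
`199 ≡ 7 (mod 8)` prime, `(−199/7) = 1`, (−199/5) = 1. The member `49a1^{(−40)}` is an O11 pair at `7`
(CM by `ℚ(√−7)`, `7` ramified) and ADDITIVE at `2`, hence NOT in `𝒞₇`: only BSD₇ is drawn. The
Kronecker value `χ_{−40}(j) = [j odd]·(−10/j)` of the class theorem is rewritten in its reciprocity
form `χ₈'(j)·(j/5)` (`kroneckerVal_E40_eq`, from `RouteUKroneckerReciprocity`), so that the per-member
inputs are two kernel certificates (`decide +kernel` with Euler's criterion in `ℕ`-arithmetic,
`RouteUEulerCriterionNat.jacobiSym_prime_eq_ite_nat`; mod-`49` sums of lengths `280` and `55720`, the second in 6 blocks of ≤ 10000 terms):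
* `norm_generalizedBernoulli_theta1_E40` — `‖B_{1,ω⁴χ_{−40}}‖₇ = 1`;
* `norm_generalizedBernoulli_theta2_E40` — `‖B_{1,ωχ_{−40}χ_{−199}}‖₇ = 1`;
* **`bsdp_seven_of_twist_cm7_E40`** — BSD₇ for every globally minimal model of `49a1^{(−40)}` with
  `r_an = 1`, from the class theorem (named facts: Kriz–Li Thm 1.20 / Rem 3.10, Gross–Zagier, Kolyvagin,
  GZK, modularity, Rubin 1983 Thm C, Burungale–Flach 2024, Buhler–Gross 1985 Ch. II; displayed data:
  Heegner datum over `ℚ(√−199)`, a Mordell–Weil coordinate over `K`, `L(W^{(−199)},1) ≠ 0`, the twin's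
  minimal model, `7 ∤ c` (Manin constant)).
THEOREMS ONLY; nothing booked. References: [KrizLi2019] Thm. 1.20; [Washington1997] §5.1, Thm 4.2;
[Rubin1983] Thm C; [BuhlerGross1985] Ch. II; [BurungaleFlach2024] Thm 1.1; [Cox2013] Lemma 1.14.
-/

noncomputable section

open scoped Classical NumberTheorySymbols
open NumberField WeierstrassCurve DirichletCharacter
open Literature.NumberTheory.EllipticCurves Literature.NumberTheory.EllipticCurves.Rank1Residual
open Literature.NumberTheory.EllipticCurves.KrizLi2019 Literature.NumberTheory.LFunctions
open Literature.NumberTheory.EllipticCurves.ModularForms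

namespace Summit.BirchSwinnertonDyer.Rank1Residual.X12.O11.RouteU

/-- `ord₇ (7·40) = 1`. [folklore] -/
theorem padicValNat_seven_level1_E40 : padicValNat 7 (7 * (4 * 10)) = 1 := by
  rw [padicValNat.mul (by norm_num) (by norm_num), padicValNat_self, padicValNat.eq_zero_of_not_dvd (by norm_num)]

/-- `ord₇ (7·40·199) = 1`. [folklore] -/
theorem padicValNat_seven_level2_E40 : padicValNat 7 (7 * (4 * 10) * 199) = 1 := by
  rw [show (7 * (4 * 10) * 199 : ℕ) = 7 * (40 * 199) by norm_num, padicValNat.mul (by norm_num) (by norm_num),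
    padicValNat_self, padicValNat.eq_zero_of_not_dvd (by norm_num)]

/-- **The Kronecker value of `D = −40` in reciprocity form**: `[a odd]·(−10/a) = χ₈'(a)·(a/5)`, the
`2`-part written as nested `if`s on `a mod 8`. [cite: Cox2013, §1.C Lemma 1.14 and (1.15)–(1.18)] -/
theorem kroneckerVal_E40_eq (a : ℕ) :
    (if Even a then (0 : ℤ) else J(-((10 : ℕ) : ℤ) | a)) = (if a % 2 = 0 then (0 : ℤ) else if a % 8 = 1 ∨ a % 8 = 3 then 1 else -1) * J((a : ℤ) | 5) := by
  by_cases ha0 : Even a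
  · rw [if_pos ha0, if_pos (Nat.even_iff.mp ha0), zero_mul]
  · have ha : Odd a := Nat.not_even_iff_odd.mp ha0
    rw [if_neg ha0]
    rw [show (-((10 : ℕ) : ℤ)) = -(2 * ((5 : ℕ) : ℤ)) by norm_num]
    rw [jacobiSym_neg_two_mul_eq_χ₈'_mul (n₀ := 5) (by norm_num) ha, ZMod.χ₈'_nat_eq_if_mod_eight]

set_option maxRecDepth 400000 in
/-- **`‖B_{1,θ₁}‖₇ = 1`** for every character `θ₁` mod `7·40` with values `χ_{−40}(j)·ω(j)⁴`, `ω`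
Teichmüller (certificate `7 ∥ Σ_{j<280} χ_{−40}(j) j²⁹`, `decide +kernel`).
[cite: KrizLi2019, Thm. 1.20 (p. 8) and §1.5 (1)] [cite: Washington1997, §5.1 and Thm. 4.2] -/
theorem norm_generalizedBernoulli_theta1_E40 (ω : DirichletCharacter ℚ_[7] 7)
    (hω : IsTeichmullerCharacter ω) (θ : DirichletCharacter ℚ_[7] (7 * (4 * 10)))
    (hθ : ∀ j : ZMod (7 * (4 * 10)), θ j =
      ((if Even j.val then (0 : ℤ) else J(-((10 : ℕ) : ℤ) | j.val) : ℤ) : ℚ_[7]) * ω (j.val : ZMod 7) ^ 4) :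
    ‖generalizedBernoulli 1 θ‖ = 1 := by
  have hθ' : ∀ j : ZMod (7 * (4 * 10)), θ j =
      (((if j.val % 2 = 0 then (0 : ℤ) else if j.val % 8 = 1 ∨ j.val % 8 = 3 then 1 else -1) * J((j.val : ℤ) | 5) : ℤ) : ℚ_[7]) * ω (j.val : ZMod 7) ^ 4 :=
    fun j => by rw [hθ j, kroneckerVal_E40_eq]
  have hθ1 : θ ≠ 1 := by
    intro h1
    have hv := hθ' (((279 : ℕ)) : ZMod (7 * (4 * 10)))
    have hval : (((279 : ℕ) : ZMod (7 * (4 * 10)))).val = 279 := by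
      rw [ZMod.val_natCast]
    have h6 : (((279 : ℕ)) : ZMod 7) = ((6 : ℕ) : ZMod 7) := by decide
    have hu : IsUnit (((279 : ℕ)) : ZMod (7 * (4 * 10))) := by
      rw [ZMod.isUnit_iff_coprime]; norm_num
    rw [h1, hval, MulChar.one_apply hu, h6, apply_neg_one_pow_four, mul_one] at hv
    have hL : ((if (279 : ℕ) % 2 = 0 then (0 : ℤ) else if (279 : ℕ) % 8 = 1 ∨ (279 : ℕ) % 8 = 3 then 1 else -1) * J(((279 : ℕ) : ℤ) | 5)) = -1 := by
      rw [jacobiSym_prime_eq_ite_nat 5 (by norm_num) (by norm_num)]; decide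
    rw [hL] at hv
    norm_num at hv
  refine norm_generalizedBernoulli_one_eq_one_of_cert_range θ hθ1 padicValNat_seven_level1_E40
    (fun j => (if j % 2 = 0 then (0 : ℤ) else if j % 8 = 1 ∨ j % 8 = 3 then 1 else -1) * J((j : ℤ) | 5)) 28 (fun j => ?_) (-131085964810332408575055240138006460355067202604230865651282853341801840) ?_ (by norm_num) (by norm_num)
  · have := norm_sub_le_of_values ω hω θ (fun j => (if j % 2 = 0 then (0 : ℤ) else if j % 8 = 1 ∨ j % 8 = 3 then 1 else -1) * J((j : ℤ) | 5)) 4 (by norm_num) hθ' j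
    simpa using this
  · simp_rw [jacobiSym_prime_eq_ite_nat 5 (by norm_num) (by norm_num)]; decide +kernel

set_option maxRecDepth 400000 in
/-- Block 0 of the `θ₂` certificate for `D = −40`: `Σ_{0 ≤ j < 10000} χ_D(j)(j/199) j⁸` evaluated (`decide +kernel`). [folklore] -/
theorem theta2_E40_block0 :
    ∑ j ∈ Finset.Ico (0 : ℕ) 10000,
      ((if j % 2 = 0 then (0 : ℤ) else if j % 8 = 1 ∨ j % 8 = 3 then 1 else -1) * J((j : ℤ) | 5) * J((j : ℤ) | 199)) * (j : ℤ) ^ (7 + 1) = (899395290537443101274996224584184) := by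
  simp_rw [jacobiSym_prime_eq_ite_nat 5 (by norm_num) (by norm_num), jacobiSym_prime_eq_ite_nat 199 (by norm_num) (by norm_num)]
  decide +kernel

set_option maxRecDepth 400000 in
/-- Block 1 of the `θ₂` certificate for `D = −40`: `Σ_{10000 ≤ j < 20000} χ_D(j)(j/199) j⁸` evaluated (`decide +kernel`). [folklore] -/
theorem theta2_E40_block1 :
    ∑ j ∈ Finset.Ico (10000 : ℕ) 20000,
      ((if j % 2 = 0 then (0 : ℤ) else if j % 8 = 1 ∨ j % 8 = 3 then 1 else -1) * J((j : ℤ) | 5) * J((j : ℤ) | 199)) * (j : ℤ) ^ (7 + 1) = (-551575093026303648349184906184084672) := by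
  simp_rw [jacobiSym_prime_eq_ite_nat 5 (by norm_num) (by norm_num), jacobiSym_prime_eq_ite_nat 199 (by norm_num) (by norm_num)]
  decide +kernel

set_option maxRecDepth 400000 in
/-- Block 2 of the `θ₂` certificate for `D = −40`: `Σ_{20000 ≤ j < 30000} χ_D(j)(j/199) j⁸` evaluated (`decide +kernel`). [folklore] -/
theorem theta2_E40_block2 :
    ∑ j ∈ Finset.Ico (20000 : ℕ) 30000,
      ((if j % 2 = 0 then (0 : ℤ) else if j % 8 = 1 ∨ j % 8 = 3 then 1 else -1) * J((j : ℤ) | 5) * J((j : ℤ) | 199)) * (j : ℤ) ^ (7 + 1) = (-10328920960213404356861394033036234732) := by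
  simp_rw [jacobiSym_prime_eq_ite_nat 5 (by norm_num) (by norm_num), jacobiSym_prime_eq_ite_nat 199 (by norm_num) (by norm_num)]
  decide +kernel

set_option maxRecDepth 400000 in
/-- Block 3 of the `θ₂` certificate for `D = −40`: `Σ_{30000 ≤ j < 40000} χ_D(j)(j/199) j⁸` evaluated (`decide +kernel`). [folklore] -/
theorem theta2_E40_block3 :
    ∑ j ∈ Finset.Ico (30000 : ℕ) 40000,
      ((if j % 2 = 0 then (0 : ℤ) else if j % 8 = 1 ∨ j % 8 = 3 then 1 else -1) * J((j : ℤ) | 5) * J((j : ℤ) | 199)) * (j : ℤ) ^ (7 + 1) = (156842020909045198254056192636110068355) := by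
  simp_rw [jacobiSym_prime_eq_ite_nat 5 (by norm_num) (by norm_num), jacobiSym_prime_eq_ite_nat 199 (by norm_num) (by norm_num)]
  decide +kernel

set_option maxRecDepth 400000 in
/-- Block 4 of the `θ₂` certificate for `D = −40`: `Σ_{40000 ≤ j < 50000} χ_D(j)(j/199) j⁸` evaluated (`decide +kernel`). [folklore] -/
theorem theta2_E40_block4 :
    ∑ j ∈ Finset.Ico (40000 : ℕ) 50000,
      ((if j % 2 = 0 then (0 : ℤ) else if j % 8 = 1 ∨ j % 8 = 3 then 1 else -1) * J((j : ℤ) | 5) * J((j : ℤ) | 199)) * (j : ℤ) ^ (7 + 1) = (61544549723202558778199596782343228472) := by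
  simp_rw [jacobiSym_prime_eq_ite_nat 5 (by norm_num) (by norm_num), jacobiSym_prime_eq_ite_nat 199 (by norm_num) (by norm_num)]
  decide +kernel

set_option maxRecDepth 400000 in
/-- Block 5 of the `θ₂` certificate for `D = −40`: `Σ_{50000 ≤ j < 55720} χ_D(j)(j/199) j⁸` evaluated (`decide +kernel`). [folklore] -/
theorem theta2_E40_block5 :
    ∑ j ∈ Finset.Ico (50000 : ℕ) (7 * (4 * 10) * 199),
      ((if j % 2 = 0 then (0 : ℤ) else if j % 8 = 1 ∨ j % 8 = 3 then 1 else -1) * J((j : ℤ) | 5) * J((j : ℤ) | 199)) * (j : ℤ) ^ (7 + 1) = (331988670233843525441033315984223679993) := by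
  simp_rw [jacobiSym_prime_eq_ite_nat 5 (by norm_num) (by norm_num), jacobiSym_prime_eq_ite_nat 199 (by norm_num) (by norm_num)]
  decide +kernel

/-- The `θ₂` certificate sum for `D = −40` assembled from its blocks, `7 ∥ S₂`. [folklore] -/
theorem theta2_E40_sum :
    ∑ j ∈ Finset.range (7 * (4 * 10) * 199),
      ((if j % 2 = 0 then (0 : ℤ) else if j % 8 = 1 ∨ j % 8 = 3 then 1 else -1) * J((j : ℤ) | 5) * J((j : ℤ) | 199)) * (j : ℤ) ^ (7 + 1) = (539495644208142111911179801459681241600) := by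
  rw [Finset.range_eq_Ico, ← Finset.sum_Ico_consecutive _ (show 0 ≤ 10000 by norm_num) (show 10000 ≤ 7 * (4 * 10) * 199 by norm_num),
    ← Finset.sum_Ico_consecutive _ (show 10000 ≤ 20000 by norm_num) (show 20000 ≤ 7 * (4 * 10) * 199 by norm_num),
    ← Finset.sum_Ico_consecutive _ (show 20000 ≤ 30000 by norm_num) (show 30000 ≤ 7 * (4 * 10) * 199 by norm_num),
    ← Finset.sum_Ico_consecutive _ (show 30000 ≤ 40000 by norm_num) (show 40000 ≤ 7 * (4 * 10) * 199 by norm_num),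
    ← Finset.sum_Ico_consecutive _ (show 40000 ≤ 50000 by norm_num) (show 50000 ≤ 7 * (4 * 10) * 199 by norm_num),
    theta2_E40_block0, theta2_E40_block1, theta2_E40_block2, theta2_E40_block3, theta2_E40_block4, theta2_E40_block5]
  norm_num

set_option maxRecDepth 400000 in
/-- **`‖B_{1,θ₂}‖₇ = 1`** for every character `θ₂` mod `7·40·199` with values `χ_{−40}(j)·(j/199)·ω(j)`
(certificate `7 ∥ Σ_{j<55720} χ_{−40}(j)(j/199) j⁸`, `decide +kernel`).
[cite: KrizLi2019, Thm. 1.20 (p. 8) and §1.5 (1)] [cite: Washington1997, §5.1 and Thm. 4.2] -/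
theorem norm_generalizedBernoulli_theta2_E40 (ω : DirichletCharacter ℚ_[7] 7)
    (hω : IsTeichmullerCharacter ω) (θ : DirichletCharacter ℚ_[7] (7 * (4 * 10) * 199))
    (hθ : ∀ j : ZMod (7 * (4 * 10) * 199), θ j =
      (((if Even j.val then (0 : ℤ) else J(-((10 : ℕ) : ℤ) | j.val)) * J((j.val : ℤ) | 199) : ℤ) : ℚ_[7]) *
        ω (j.val : ZMod 7) ^ 1) :
    ‖generalizedBernoulli 1 θ‖ = 1 := by
  have hθ' : ∀ j : ZMod (7 * (4 * 10) * 199), θ j =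
      (((if j.val % 2 = 0 then (0 : ℤ) else if j.val % 8 = 1 ∨ j.val % 8 = 3 then 1 else -1) * J((j.val : ℤ) | 5) * J((j.val : ℤ) | 199) : ℤ) : ℚ_[7]) * ω (j.val : ZMod 7) ^ 1 :=
    fun j => by rw [hθ j, kroneckerVal_E40_eq]
  have hθ1 : θ ≠ 1 := by
    intro h1
    have hv := hθ' (((55719 : ℕ)) : ZMod (7 * (4 * 10) * 199))
    have hval : (((55719 : ℕ) : ZMod (7 * (4 * 10) * 199))).val = 55719 := by
      rw [ZMod.val_natCast]
    have hu : IsUnit (((55719 : ℕ)) : ZMod (7 * (4 * 10) * 199)) := by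
      rw [ZMod.isUnit_iff_coprime]; norm_num
    rw [h1, hval, MulChar.one_apply hu, pow_one] at hv
    have hL : ((if (55719 : ℕ) % 2 = 0 then (0 : ℤ) else if (55719 : ℕ) % 8 = 1 ∨ (55719 : ℕ) % 8 = 3 then 1 else -1) * J(((55719 : ℕ) : ℤ) | 5) * J(((55719 : ℕ) : ℤ) | 199)) = 1 := by
      rw [jacobiSym_prime_eq_ite_nat 5 (by norm_num) (by norm_num), jacobiSym_prime_eq_ite_nat 199 (by norm_num) (by norm_num)]; decide
    rw [hL, Int.cast_one, one_mul] at hv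
    -- `ω(−1) = 1` contradicts `‖ω(6) − 6‖ < 1`
    have h6 : (((55719 : ℕ)) : ZMod 7) = ((6 : ℤ) : ZMod 7) := by decide
    rw [h6] at hv
    have hT := hω 6 (by decide)
    rw [← hv] at hT
    have : ‖(1 : ℚ_[7]) - ((6 : ℤ) : ℚ_[7])‖ = 1 := by
      rw [show (1 : ℚ_[7]) - ((6 : ℤ) : ℚ_[7]) = -((5 : ℕ) : ℚ_[7]) by norm_num, norm_neg]
      exact Padic.norm_natCast_eq_one_iff.mpr (by decide)
    rw [this] at hT
    exact lt_irrefl _ hT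
  refine norm_generalizedBernoulli_one_eq_one_of_cert_range θ hθ1 padicValNat_seven_level2_E40
    (fun j => (if j % 2 = 0 then (0 : ℤ) else if j % 8 = 1 ∨ j % 8 = 3 then 1 else -1) * J((j : ℤ) | 5) * J((j : ℤ) | 199)) 7 (fun j => ?_) (539495644208142111911179801459681241600)
    theta2_E40_sum (by norm_num) (by norm_num)
  have := norm_sub_le_of_values ω hω θ (fun j => (if j % 2 = 0 then (0 : ℤ) else if j % 8 = 1 ∨ j % 8 = 3 then 1 else -1) * J((j : ℤ) | 5) * J((j : ℤ) | 199)) 1 le_rfl hθ' j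
  simpa using this

/-- **ROUTE U, EVEN member `D = −40` (`49a1^{(−40)}`, `N = 78400`): BSD₇ for every globally minimal
model of `49a1^{(−40)}` with `r_an = 1`**, by the even-member class theorem at `(n, r) = (10, 199)` with the
two certificates above; the descent inputs (no `7`-torsion over `K`, `7 ∤ #Ш(W)`) are discharged inside
the class theorem (Mazur's local step; Buhler–Gross 1985 Ch. II BY NAME over `ℚ(√−10)`, binder `hBG`).
[cite: KrizLi2019, Thm. 1.20 and Rem. 3.10] [cite: Rubin1983, §0 Thm. C (p. 341)]
[cite: BurungaleFlach2024, Thm 1.1 and Cor. 2] [cite: GrossZagier1986, I.(6.5) and V.(2.1)]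
[cite: Miller2011LMS, Thm. 2.5 and (5.1)] [cite: BuhlerGross1985, Ch. II (7.2)(2), (8.3)(1), (9.1) (pp. 16–18)] -/
theorem bsdp_seven_of_twist_cm7_E40
    (hKL : KrizLi2019.thm120_padicLogHeegner_unit_of_bernoulli)
    (hRem : KrizLi2019.rem310_padicLogHeegner_integral)
    (W : WeierstrassCurve ℚ) [W.IsElliptic] [W.IsGloballyMinimal] [NeZero (W.conductorNorm ℤ)]
    (hW : ∃ C : VariableChange ℚ, C • W = cm7.quadraticTwist ((-(4 * ((10 : ℕ) : ℤ)) : ℤ) : ℚ))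
    (K : Type) [Field K] [NumberField K] [NeZero (NumberField.discr K).natAbs]
    (hK : IsImaginaryQuadratic K) (hdK : NumberField.discr K = -(199 : ℕ))
    (D : ModularParametrizationData W (W.conductorNorm ℤ))
    (H : HeegnerDatum (W.conductorNorm ℤ) (NumberField.discr K)) (ι : K →+* ℂ) (ιp : K →+* ℚ_[7])
    (P : (W.baseChange K).toAffine.Point)
    (hGZ : gross_zagier (W.conductorNorm ℤ) W K) (hKo : kolyvagin (W.conductorNorm ℤ) W K)
    (hGZK : rank_eq_analyticRank_of_analyticRank_le_one) (hmod : hasEntireLFunction_rat)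
    (hP : WeierstrassCurve.Affine.Point.map ι.toRatAlgHom P = heegnerPointComplex D H)
    (hr1 : W.analyticRank = 1)
    (hLt : (W.quadraticTwist (NumberField.discr K : ℚ)).entireLFunction 1 ≠ 0)
    (Wd : WeierstrassCurve ℚ) [Wd.IsElliptic] [Wd.IsGloballyMinimal] (Cd : VariableChange ℚ)
    (hWd : Cd • W.quadraticTwist (NumberField.discr K : ℚ) = Wd)
    (hBF : bsdTriple_of_hasCM_of_L_one_ne_zero)
    (hu : padicValRat 7 (Cd.u : ℚ) = 0)
    (hC : Rubin1983.thmC_seven_quadraticField)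
    (hBG : BuhlerGross1985.firstDescent_seven_oddTwist_of_bernoulli)
    [Finite (AddCommGroup.torsion (W.baseChange K).toAffine.Point)]
    (crd : (W.baseChange K).toAffine.Point →+ ℤ) (g : (W.baseChange K).toAffine.Point)
    (hg : crd g = 1) (hker : ∀ x, crd x = 0 → IsOfFinAddOrder x)
    (hc7 : ¬ ((7 : ℤ) ∣ D.c)) :
    BSDp W 7 :=
  bsdp_seven_of_twist_cm7_even (n := 10) (r := 199) (hn := ⟨by norm_num⟩) (hr := ⟨by norm_num⟩)
    (by norm_num) (by rw [show (10 : ℕ) = 2 * 5 by norm_num]; exact (Nat.squarefree_mul (by norm_num)).mpr ⟨(show Nat.Prime 2 by norm_num).squarefree, (show Nat.Prime 5 by norm_num).squarefree⟩) (by norm_num) (by norm_num) (by norm_num) (by norm_num) (by norm_num)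
    (by rw [legendreSym_eq_ite 7 (by norm_num)]; decide)
    (fun q hq hqn hq2 => by
      rcases (Nat.Prime.dvd_mul hq : q ∣ 2 * 5 ↔ _).mp (by simpa using hqn) with h | h
      · exact absurd ((Nat.prime_dvd_prime_iff_eq hq Nat.prime_two).mp h) hq2
      · rw [(Nat.prime_dvd_prime_iff_eq hq (by norm_num : Nat.Prime 5)).mp h,
          jacobiSym_prime_eq_ite 5 (by norm_num) (by norm_num)]; decide)
    (norm_generalizedBernoulli_theta1_E40) (norm_generalizedBernoulli_theta2_E40)
    hKL hRem W hW K hK hdK D H ι ιp P hGZ hKo hGZK hmod hP hr1 hLt Wd Cd hWd hBF hu hC hBG crd g hg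
    hker hc7

end Summit.BirchSwinnertonDyer.Rank1Residual.X12.O11.RouteU

end
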